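import Literature.Topology.FourManifolds.BoxLevelPackage
import Literature.Topology.FourManifolds.PlanarSurfaceTwist
import HarnessLib

/-!
# Dehn twists of the boundary surface of a thickened planar domain about the curves `{f = a}`

Topic `Literature/Topology/FourManifolds`; generic form of `PlanarSurfaceTwist.lean` (there the
curves are the hole circles `{z = h}`), for the Dehn twists of the Dehn–Nielsen–Baer seat
(`DehnNielsenBaerSurface.lean`).  For the thickened planar handlebody `V = {q(x, y) + z² ≤ c} ⊂ ℝ³`
with boundary surface `F = {q + z² = c}` and a smooth function `f : ℝ³ → ℝ`, the pair of first
integrals `H = (f, q ∘ π + z²)` (`pairH f q`) has as level curves ON `F` the curves `{f = a} ∩ F`;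
when `DH` is onto near such a curve (i.e. `df` and `d(q ∘ π + z²)` are independent there) the
flow of `BoxLevelPackage.lean` rotates these curves, and — exactly as in `PlanarSurfaceTwist.lean` —
the Dehn twist of `F` about the curve through `σ(a₀, c)` is glued (`RegularSublevelGlue.lean`) from
the ambient model `Φ(x) = θ(λ(f x), x)` over the open family of curves and the identity off a
compact core, `λ = 0` below the twisting annulus and `λ =` the period above it.

* `pairH f q`, `contDiff_pairH`, `thicken_eq_of_pairH_eq`, `apply_eq_of_pairH_eq`;
* `exists_min_of_isCompact_preimage` (a continuous function with compact sublevel sets attains a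
  minimum), `isCompact_thicken_preimage_Icc`, `isCompact_pairH_preimage` (`H` is proper on boxes
  when `q` has compact sublevel sets);
* `range_prod_eq_top_of_vectors` — `(φ₁, φ₂) : E → ℝ²` is onto as soon as `φ₁ v ≠ 0`, `φ₁ w = 0`,
  `φ₂ w ≠ 0` for two vectors `v, w` (the regularity test used by the instances);
* `exists_thickenSurfaceDehnTwist` — **the Dehn twist of `∂V` about the curve `{f = a₀} ∩ F`
  through `σ(a₀, c)`**: the cut-off/flow package of `exists_boxLevelPackage` for `H = pairH f q`,
  one positive period, and for every positive period `T₀` and every `ε₀ > 0` the period function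
  `P` on `S`, a width `0 < ε ≤ ε₀` with `(a, c) ∈ S` for `a ∈ [a₀ - 3ε, a₀ + 3ε]`, a smooth `λ`
  (`= 0` on `(-∞, a₀ - ε]`, `λ a = P(a, c)` on `[a₀, a₀ + 2ε]`) and a diffeomorphism `T` of `∂V`
  equal to `x ↦ θ(λ(f x), x)` at the boundary points of the family with `f < a₀ + 2ε` and to the
  identity at those off the family or with `f ∉ [a₀ - ε, a₀]`.

Everything is proved; one definition (`pairH`); no named facts (D-0026).

## References

* B. Farb, D. Margalit, *A primer on mapping class groups*, PMS 49 (2012), §3.1.1 (the twist map,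
  PDF p. 62). [FarbMargalit2012]
* J. M. Lee, *Introduction to Smooth Manifolds* (2013), Cor. 5.30. [LeeSmoothManifolds2013]
-/

open scoped Manifold ContDiff Topology
open Set Function Filter Metric

noncomputable section

namespace Literature.Topology.FourManifolds

open PlanarThickening Literature.Geometry.Manifold

/-- Local notation: `𝔼 n` is the model Euclidean space `EuclideanSpace ℝ (Fin n)`. -/
local notation "𝔼 " n:arg => EuclideanSpace ℝ (Fin n)

namespace PlanarLevelTwist

variable {q : 𝔼 2 → ℝ} {f : 𝔼 3 → ℝ}

/-! ### §1 The first integrals `H = (f, q ∘ π + z²)` -/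

/-- **The first integrals** `H(x) = (f x, q(π x) + z²)`. [folklore] -/
def pairH (f : 𝔼 3 → ℝ) (q : 𝔼 2 → ℝ) (x : 𝔼 3) : ℝ × ℝ := (f x, thicken q x)

/-- `pairH` unfolded. [folklore] -/
@[simp] theorem pairH_apply (f : 𝔼 3 → ℝ) (q : 𝔼 2 → ℝ) (x : 𝔼 3) :
    pairH f q x = (f x, thicken q x) := rfl

/-- `q ∘ π + z²` is a function of `H`. [folklore] -/
theorem thicken_eq_of_pairH_eq {x y : 𝔼 3} (h : pairH f q x = pairH f q y) :
    thicken q x = thicken q y := by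
  simp only [pairH_apply, Prod.mk.injEq] at h
  exact h.2

/-- `f` is a function of `H`. [folklore] -/
theorem apply_eq_of_pairH_eq {x y : 𝔼 3} (h : pairH f q x = pairH f q y) : f x = f y := by
  simp only [pairH_apply, Prod.mk.injEq] at h
  exact h.1

/-- `H` is smooth. [folklore] -/
theorem contDiff_pairH (hf : ContDiff ℝ ∞ f) (hq : ContDiff ℝ ∞ q) : ContDiff ℝ ∞ (pairH f q) :=
  hf.prodMk (contDiff_thicken hq)

/-! ### §2 Properness -/

/-- A continuous function with compact sublevel sets attains its infimum. [folklore] -/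
theorem exists_min_of_isCompact_preimage (hqc : Continuous q) (hcoer : ∀ s, IsCompact (q ⁻¹' Iic s)) :
    ∃ m : ℝ, ∀ p, m ≤ q p := by
  obtain ⟨p₀, hp₀, hmin⟩ :=
    (hcoer (q 0)).exists_isMinOn ⟨0, show q 0 ≤ q 0 from le_rfl⟩ hqc.continuousOn
  refine ⟨q p₀, fun p => ?_⟩
  by_cases hp : q p ≤ q 0
  · exact hmin hp
  · exact le_trans (show q p₀ ≤ q 0 from hp₀) (not_le.1 hp).le

/-- **`{a ≤ q ∘ π + z² ≤ b}` is compact** when `q` has compact sublevel sets. [folklore] -/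
theorem isCompact_thicken_preimage_Icc (hqc : Continuous q) (hcoer : ∀ s, IsCompact (q ⁻¹' Iic s))
    (a b : ℝ) : IsCompact (thicken q ⁻¹' Icc a b) := by
  obtain ⟨m, hm⟩ := exists_min_of_isCompact_preimage hqc hcoer
  obtain ⟨R, hR⟩ := (hcoer b).isBounded.subset_closedBall 0
  refine Metric.isCompact_of_isClosed_isBounded
    (isClosed_Icc.preimage (contDiff_thicken_continuous hqc)) ?_
  refine (isBounded_closedBall (x := (0 : 𝔼 3)) (r := |R| + Real.sqrt (b - m))).subset
    fun x hx => ?_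
  simp only [mem_preimage, thicken_apply, mem_Icc] at hx
  have hq : q (proj x) ≤ b := by linarith [hx.2, sq_nonneg (x 2)]
  have hp : proj x ∈ closedBall (0 : 𝔼 2) R := hR hq
  rw [mem_closedBall, dist_zero_right] at hp ⊢
  have hlift : ‖lift (proj x)‖ ≤ |R| := by
    have : ‖lift (proj x)‖ = ‖proj x‖ := by
      rw [EuclideanSpace.norm_eq, EuclideanSpace.norm_eq]
      congr 1
      simp [Fin.sum_univ_three, Fin.sum_univ_two]
    rw [this]; exact hp.trans (le_abs_self R)
  have hz : |x 2| ≤ Real.sqrt (b - m) := by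
    refine Real.abs_le_sqrt ?_
    have := hm (proj x); linarith [hx.2]
  calc ‖x‖ = ‖lift (proj x) + x 2 • ez‖ := by rw [lift_proj_add]
    _ ≤ ‖lift (proj x)‖ + ‖x 2 • ez‖ := norm_add_le _ _
    _ ≤ |R| + Real.sqrt (b - m) := by
      refine add_le_add hlift ?_
      rw [norm_smul, Real.norm_eq_abs]
      have : ‖ez‖ = 1 := by rw [EuclideanSpace.norm_eq]; simp [Fin.sum_univ_three]
      rw [this, mul_one]
      exact hz
where
  /-- continuity of `thicken q` from continuity of `q` -/
  contDiff_thicken_continuous (hqc : Continuous q) : Continuous (thicken q) :=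
    (hqc.comp proj.continuous).add (zc.continuous.pow 2)

/-- **`H = (f, q ∘ π + z²)` is proper on boxes** when `q` has compact sublevel sets and `f` is
continuous. [folklore] -/
theorem isCompact_pairH_preimage (hfc : Continuous f) (hqc : Continuous q)
    (hcoer : ∀ s, IsCompact (q ⁻¹' Iic s)) (a b a' b' : ℝ) :
    IsCompact (pairH f q ⁻¹' (Icc a b ×ˢ Icc a' b')) := by
  refine (isCompact_thicken_preimage_Icc hqc hcoer a' b').of_isClosed_subset ?_ fun x hx => hx.2
  exact (isClosed_Icc.prod isClosed_Icc).preimage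
    (hfc.prodMk (isCompact_thicken_preimage_Icc.contDiff_thicken_continuous hqc))

/-! ### §3 The regularity test -/

/-- **A pair of functionals is onto `ℝ²`** as soon as there are vectors `v`, `w` with `φ₁ v ≠ 0`,
`φ₁ w = 0`, `φ₂ w ≠ 0`. [folklore] -/
theorem range_prod_eq_top_of_vectors {E : Type*} [AddCommGroup E] [Module ℝ E]
    [TopologicalSpace E] (φ₁ φ₂ : E →L[ℝ] ℝ) {v w : E} (hv : φ₁ v ≠ 0) (hw₁ : φ₁ w = 0)
    (hw₂ : φ₂ w ≠ 0) : LinearMap.range ((φ₁.prod φ₂ : E →L[ℝ] ℝ × ℝ) : E →ₗ[ℝ] ℝ × ℝ) = ⊤ := by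
  rw [LinearMap.range_eq_top]
  rintro ⟨a, b⟩
  refine ⟨(a / φ₁ v) • v + ((b - a / φ₁ v * φ₂ v) / φ₂ w) • w, Prod.ext ?_ ?_⟩
  · simp [hw₁, div_mul_cancel₀ a hv]
  · simp only [ContinuousLinearMap.coe_coe, ContinuousLinearMap.prod_apply, map_add, map_smul,
      Prod.snd_add, Prod.smul_snd, smul_eq_mul]
    rw [div_mul_cancel₀ _ hw₂]
    ring

/-- **Regularity of `H = (f, q ∘ π + z²)`** from two test vectors. [folklore] -/
theorem range_fderiv_pairH_eq_top (hf : Differentiable ℝ f) (hq : Differentiable ℝ q) {x v w : 𝔼 3}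
    (hv : fderiv ℝ f x v ≠ 0) (hw₁ : fderiv ℝ f x w = 0) (hw₂ : fderiv ℝ (thicken q) x w ≠ 0) :
    LinearMap.range (fderiv ℝ (pairH f q) x : 𝔼 3 →ₗ[ℝ] ℝ × ℝ) = ⊤ := by
  have hd : HasFDerivAt (pairH f q) ((fderiv ℝ f x).prod (fderiv ℝ (thicken q) x)) x :=
    (hf x).hasFDerivAt.prodMk
      ((hasFDerivAt_thicken (hq (proj x)).hasFDerivAt).differentiableAt.hasFDerivAt)
  rw [hd.fderiv]
  exact range_prod_eq_top_of_vectors _ _ hv hw₁ hw₂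

/-! ### §4 A smooth cut-off product (copy of `PlanarSurfaceTwist`, real variable) -/

/-! ### §5 The Dehn twist of the boundary surface about a curve `{f = a₀}` -/

/-- **The Dehn twist of the boundary surface `F = {q + z² = c}` about the curve `{f = a₀} ∩ F`
through `σ(a₀, c)`** (Farb–Margalit's twist map realised on `F`).  Data: `q` smooth with compact
sublevel sets, `c` a regular value of `q ∘ π + z²`, `f` smooth, a band `[a₁, a₂] ∋ a₀` of values of
`f` and `δ > 0` such that `D(f, q ∘ π + z²)` is onto on the preimage of the box
`(a₁ - δ, a₂ + δ) × (c - δ, c + δ)`, and a smooth `σ : ℝ² → ℝ³` which is a section of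
`H = (f, q ∘ π + z²)` over that box.  Conclusion: see the file header.
[cite: FarbMargalit2012, §3.1.1] [cite: LeeSmoothManifolds2013, Cor. 5.30] -/
theorem exists_thickenSurfaceDehnTwist (hq : ContDiff ℝ ∞ q) (hcoer : ∀ s, IsCompact (q ⁻¹' Iic s))
    (hf : ContDiff ℝ ∞ f) {c : ℝ} (hlev : IsRegularLevel (𝓡 3) (thicken q) c)
    {a₁ a₂ δ : ℝ} (hδ : 0 < δ)
    (hreg : ∀ x, pairH f q x ∈ Ioo (a₁ - δ) (a₂ + δ) ×ˢ Ioo (c - δ) (c + δ) →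
      LinearMap.range (fderiv ℝ (pairH f q) x : 𝔼 3 →ₗ[ℝ] ℝ × ℝ) = ⊤)
    {σ : ℝ × ℝ → 𝔼 3} (hσ : ContDiff ℝ ∞ σ)
    (hHσ : ∀ s ∈ Ioo (a₁ - δ) (a₂ + δ) ×ˢ Ioo (c - δ) (c + δ), pairH f q (σ s) = s)
    {a₀ : ℝ} (ha₀ : a₀ ∈ Icc a₁ a₂) :
    ∃ (ψ : 𝔼 3 → ℝ) (θ : ℝ × 𝔼 3 → 𝔼 3), ContDiff ℝ ∞ ψ ∧
      (∀ x, pairH f q x ∈ Ioo (a₁ - δ) (a₂ + δ) ×ˢ Ioo (c - δ) (c + δ) → ψ x = 1) ∧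
      (∀ x, pairH f q x ∉ Ioo (a₁ - 2 * δ) (a₂ + 2 * δ) ×ˢ Ioo (c - 2 * δ) (c + 2 * δ) →
        ψ x = 0) ∧
      ContDiff ℝ ∞ θ ∧ (∀ x, θ (0, x) = x) ∧ (∀ t s x, θ (t, θ (s, x)) = θ (t + s, x)) ∧
      (∀ x t, HasDerivAt (fun t => θ (t, x)) (twistField bE3 bF2 (pairH f q) ψ (θ (t, x))) t) ∧
      (∀ t x, pairH f q (θ (t, x)) = pairH f q x) ∧
      (∀ x, ψ x = 0 → ∀ t, θ (t, x) = x) ∧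
      (∃ T₀ : ℝ, 0 < T₀ ∧ θ (T₀, σ (a₀, c)) = σ (a₀, c)) ∧
      ∀ T₀ : ℝ, 0 < T₀ → θ (T₀, σ (a₀, c)) = σ (a₀, c) → ∀ ε₀ : ℝ, 0 < ε₀ →
        ∃ (P : ℝ × ℝ → ℝ) (S : Set (ℝ × ℝ)) (ε : ℝ) (lam : ℝ → ℝ)
          (T : (𝓡∂ 3).boundary (RegularSublevel hlev) ≃ₘ⟮𝓡 2, 𝓡 2⟯
            (𝓡∂ 3).boundary (RegularSublevel hlev)),
          IsOpen S ∧ (a₀, c) ∈ S ∧ S ⊆ Ioo (a₁ - δ) (a₂ + δ) ×ˢ Ioo (c - δ) (c + δ) ∧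
          ContDiffOn ℝ ∞ P S ∧ P (a₀, c) = T₀ ∧ (∀ s ∈ S, 0 < P s) ∧
          (∀ s ∈ S, θ (P s, σ s) = σ s) ∧ IsOpen (flowSaturation θ σ S) ∧
          0 < ε ∧ ε ≤ ε₀ ∧ (∀ a ∈ Icc (a₀ - 3 * ε) (a₀ + 3 * ε), (a, c) ∈ S) ∧
          ContDiff ℝ ∞ lam ∧ (∀ a, a ≤ a₀ - ε → lam a = 0) ∧
          (∀ a ∈ Icc a₀ (a₀ + 2 * ε), lam a = P (a, c)) ∧
          (∀ z, RegularSublevel.incl hlev z.1 ∈ flowSaturation θ σ S →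
            f (RegularSublevel.incl hlev z.1) < a₀ + 2 * ε →
            RegularSublevel.incl hlev (T z).1 =
              θ (lam (f (RegularSublevel.incl hlev z.1)), RegularSublevel.incl hlev z.1)) ∧
          ∀ z, (RegularSublevel.incl hlev z.1 ∉ flowSaturation θ σ S ∨
            f (RegularSublevel.incl hlev z.1) ∉ Icc (a₀ - ε) a₀) → T z = z := by
  obtain ⟨ψ, θ, hψs, hψ1, hψzero, hθ, h0, hadd, hint, hHinv, hψfix, hper, hpack⟩ :=
    exists_boxLevelPackage (contDiff_pairH hf hq)
      (isCompact_pairH_preimage hf.continuous hq.continuous hcoer) hδ hreg hσ hHσ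
      (s₀ := (a₀, c)) ⟨ha₀, ⟨le_rfl, le_rfl⟩⟩
  refine ⟨ψ, θ, hψs, hψ1, hψzero, hθ, h0, hadd, hint, hHinv, hψfix, hper,
    fun T₀ hT₀ hT ε₀ hε₀ => ?_⟩
  obtain ⟨P, S, hSo, hs₀S, hSJ, hPs, hP0, hPpos, hPS, hopen⟩ := hpack T₀ hT₀ hT
  set par : ℝ → ℝ × ℝ := fun a => (a, c) with hpardef
  have hpars : ContDiff ℝ ∞ par := contDiff_id.prodMk contDiff_const
  have hparc : Continuous par := hpars.continuous
  have hfinv : ∀ t x, f (θ (t, x)) = f x := fun t x => apply_eq_of_pairH_eq (hHinv t x)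
  have hσf : ∀ s ∈ S, f (σ s) = s.1 := fun s hs => by
    have := hHσ s (hSJ hs); rw [pairH_apply] at this; exact (Prod.ext_iff.1 this).1
  have hσt : ∀ s ∈ S, thicken q (σ s) = s.2 := fun s hs => by
    have := hHσ s (hSJ hs); rw [pairH_apply] at this; exact (Prod.ext_iff.1 this).2
  -- the width `ε`
  have hWo : IsOpen (par ⁻¹' S) := hSo.preimage hparc
  obtain ⟨r, hr, hball⟩ := Metric.isOpen_iff.1 hWo a₀ hs₀S
  set ε : ℝ := min (r / 4) ε₀ with hεdef
  have hε : 0 < ε := lt_min (by linarith) hε₀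
  have hεε₀ : ε ≤ ε₀ := min_le_right _ _
  have hεr : 3 * ε < r := by have := min_le_left (r / 4) ε₀; linarith
  have hparS : ∀ a ∈ Icc (a₀ - 3 * ε) (a₀ + 3 * ε), par a ∈ S := fun a ha =>
    hball (by rw [mem_ball, Real.dist_eq, abs_lt]; constructor <;> linarith [ha.1, ha.2])
  -- the twist profile `λ`
  set μ₁ : ℝ → ℝ := fun a => Real.smoothTransition ((a - (a₀ - ε)) / ε) with hμ₁def
  have hμ₁s : ContDiff ℝ ∞ μ₁ :=
    Real.smoothTransition.contDiff.comp ((contDiff_id.sub contDiff_const).div_const _)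
  have hμ₁0 : ∀ a, a ≤ a₀ - ε → μ₁ a = 0 := fun a ha =>
    Real.smoothTransition.zero_of_nonpos (div_nonpos_of_nonpos_of_nonneg (by linarith) hε.le)
  have hμ₁1 : ∀ a, a₀ ≤ a → μ₁ a = 1 := fun a ha =>
    Real.smoothTransition.one_of_one_le ((one_le_div hε).2 (by linarith))
  obtain ⟨μ₂, hμ₂s, -, hμ₂1, hμ₂supp⟩ := exists_plateau (a := a₀ - ε) (b := a₀ + ε) hε
  set lam : ℝ → ℝ := fun a => μ₁ a * (μ₂ a * P (par a)) with hlamdef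
  have hlams : ContDiff ℝ ∞ lam := by
    refine hμ₁s.mul (contDiff_mul_of_support_subset hμ₂s hWo
      (hPs.comp hpars.contDiffOn fun a ha => ha) isClosed_Icc
      (fun a ha => hparS a ha) fun a ha => ?_)
    have := hμ₂supp a ha
    exact ⟨by linarith [this.1], by linarith [this.2]⟩
  have hlam0 : ∀ a, a ≤ a₀ - ε → lam a = 0 := fun a ha => by
    show μ₁ a * (μ₂ a * P (par a)) = 0
    rw [hμ₁0 a ha, zero_mul]
  have hlam1 : ∀ a ∈ Icc a₀ (a₀ + 2 * ε), lam a = P (par a) := fun a ha => by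
    show μ₁ a * (μ₂ a * P (par a)) = P (par a)
    rw [hμ₁1 a ha.1, hμ₂1 a ⟨by linarith [ha.1], by linarith [ha.2]⟩, one_mul, one_mul]
  -- the two ambient models
  set Φ : 𝔼 3 → 𝔼 3 := fun x => θ (lam (f x), x) with hΦdef
  set Φ' : 𝔼 3 → 𝔼 3 := fun x => θ (-lam (f x), x) with hΦ'def
  have hΦs : ContDiff ℝ ∞ Φ := hθ.comp ((hlams.comp hf).prodMk contDiff_id)
  have hΦ's : ContDiff ℝ ∞ Φ' := hθ.comp ((hlams.comp hf).neg.prodMk contDiff_id)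
  have hΦm : ContMDiff (𝓡 3) (𝓡 3) ∞ Φ := contMDiff_iff_contDiff.2 hΦs
  have hΦ'm : ContMDiff (𝓡 3) (𝓡 3) ∞ Φ' := contMDiff_iff_contDiff.2 hΦ's
  have hΦt : ∀ x, thicken q (Φ x) = thicken q x := fun x => thicken_eq_of_pairH_eq (hHinv _ _)
  have hΦ't : ∀ x, thicken q (Φ' x) = thicken q x := fun x => thicken_eq_of_pairH_eq (hHinv _ _)
  have hinvΦ : ∀ x, Φ' (Φ x) = x := fun x => by
    show θ (-lam (f (θ (lam (f x), x))), θ (lam (f x), x)) = x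
    rw [hfinv, hadd, neg_add_cancel, h0]
  have hinvΦ' : ∀ x, Φ (Φ' x) = x := fun x => by
    show θ (lam (f (θ (-lam (f x), x))), θ (-lam (f x), x)) = x
    rw [hfinv, hadd, add_neg_cancel, h0]
  -- the open family `O` and the compact core `K`
  set O : Set (𝔼 3) := flowSaturation θ σ S ∩ {x | f x < a₀ + 2 * ε} with hOdef
  have hOo : IsOpen O := hopen.inter (isOpen_lt hf.continuous continuous_const)
  have hcontP : ContinuousOn (fun a => P (par a)) (Icc (a₀ - ε) a₀) :=
    hPs.continuousOn.comp hparc.continuousOn fun a ha =>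
      hparS a ⟨by linarith [ha.1], by linarith [ha.2]⟩
  obtain ⟨aM, haMmem, haMmax⟩ :=
    isCompact_Icc.exists_isMaxOn (nonempty_Icc.2 (by linarith)) hcontP
  set K : Set (𝔼 3) :=
    (fun p : ℝ × ℝ => θ (p.2, σ (par p.1))) '' (Icc (a₀ - ε) a₀ ×ˢ Icc 0 (P (par aM))) with hKdef
  have hKc : IsCompact K :=
    (isCompact_Icc.prod isCompact_Icc).image
      (hθ.continuous.comp (continuous_snd.prodMk (hσ.continuous.comp (hparc.comp continuous_fst))))
  -- boundary points on the family lie on the curves of the line `a ↦ (a, c)`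
  have hSat : ∀ x ∈ flowSaturation θ σ S, thicken q x = c →
      ∃ (u a : ℝ), par a ∈ S ∧ θ (u, σ (par a)) = x ∧ f x = a := by
    intro x hx hxc
    obtain ⟨u, s', hs', rfl⟩ := mem_flowSaturation_iff.1 hx
    have hc' : s'.2 = c := by
      rw [← hσt s' hs', ← thicken_eq_of_pairH_eq (hHinv u (σ s'))]; exact hxc
    have hpar : par s'.1 = s' := Prod.ext rfl hc'.symm
    exact ⟨u, s'.1, hpar ▸ hs', by rw [hpar], by rw [hfinv, hσf s' hs']⟩
  have hKO : K ⊆ O := by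
    rintro _ ⟨⟨a, t⟩, ⟨ha, -⟩, rfl⟩
    have hSp : par a ∈ S := hparS a ⟨by linarith [ha.1], by linarith [ha.2]⟩
    refine ⟨mem_flowSaturation_iff.2 ⟨t, par a, hSp, rfl⟩, ?_⟩
    show f (θ (t, σ (par a))) < a₀ + 2 * ε
    rw [hfinv, hσf _ hSp]
    show a < a₀ + 2 * ε
    linarith [ha.2]
  have hmemK : ∀ (u a : ℝ), a ∈ Icc (a₀ - ε) a₀ → θ (u, σ (par a)) ∈ K := by
    intro u a ha
    have hSp : par a ∈ S := hparS a ⟨by linarith [ha.1], by linarith [ha.2]⟩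
    obtain ⟨r', hr', hru⟩ := exists_mem_Ico_apply_eq h0 hadd (hPpos _ hSp) (hPS _ hSp) u
    exact ⟨(a, r'), ⟨ha, ⟨hr'.1, hr'.2.le.trans (haMmax ha)⟩⟩, hru.symm⟩
  -- the gluing hypotheses along the boundary surface
  have hid : ∀ x, thicken q x = c → x ∈ O → x ∉ K → Φ x = x ∧ Φ' x = x := by
    intro x hxc hxO hxK
    obtain ⟨u, a, hSp, rfl, hxa⟩ := hSat x hxO.1 hxc
    rcases le_or_gt a (a₀ - ε) with hlo | hhi
    · have hl : lam a = 0 := hlam0 a hlo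
      constructor
      · show θ (lam (f (θ (u, σ (par a)))), θ (u, σ (par a))) = _
        rw [hxa, hl, h0]
      · show θ (-lam (f (θ (u, σ (par a)))), θ (u, σ (par a))) = _
        rw [hxa, hl, neg_zero, h0]
    · rcases le_or_gt a a₀ with hmid | htop
      · exact absurd (hmemK u a ⟨hhi.le, hmid⟩) hxK
      · have hlt : a < a₀ + 2 * ε := by
          have : f (θ (u, σ (par a))) < a₀ + 2 * ε := hxO.2
          rwa [hxa] at this
        have hl : lam a = P (par a) := hlam1 a ⟨htop.le, hlt.le⟩
        have hperx : θ (P (par a), θ (u, σ (par a))) = θ (u, σ (par a)) := by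
          rw [hadd, add_comm, ← hadd, hPS _ hSp]
        constructor
        · show θ (lam (f (θ (u, σ (par a)))), θ (u, σ (par a))) = _
          rw [hxa, hl]; exact hperx
        · show θ (-lam (f (θ (u, σ (par a)))), θ (u, σ (par a))) = _
          rw [hxa, hl]
          conv_lhs => rw [← hperx]
          rw [hadd, neg_add_cancel, h0]
  have hmaps : ∀ x, thicken q x = c → x ∈ O → Φ x ∈ O ∧ Φ' x ∈ O := by
    intro x _ hxO
    refine ⟨⟨flowSaturation_invariant hadd σ S _ hxO.1, ?_⟩,
      ⟨flowSaturation_invariant hadd σ S _ hxO.1, ?_⟩⟩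
    · show f (θ (lam (f x), x)) < a₀ + 2 * ε
      rw [hfinv]; exact hxO.2
    · show f (θ (-lam (f x), x)) < a₀ + 2 * ε
      rw [hfinv]; exact hxO.2
  have hinv : ∀ x, thicken q x = c → x ∈ O → Φ' (Φ x) = x ∧ Φ (Φ' x) = x :=
    fun x _ _ => ⟨hinvΦ x, hinvΦ' x⟩
  -- the diffeomorphism
  refine ⟨P, S, ε, lam, RegularSublevel.boundaryGlueDiffeomorph hlev hΦm hΦ'm hΦt hΦ't hOo
      hKc.isClosed hKO hid hmaps hinv, hSo, hs₀S, hSJ, hPs, hP0, hPpos, hPS, hopen, hε, hεε₀,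
    hparS, hlams, hlam0, hlam1, fun z hz hz2 => ?_, fun z hz => ?_⟩
  · exact RegularSublevel.incl_boundaryGlueDiffeomorph_of_mem hlev hΦm hΦ'm hΦt hΦ't hOo
      hKc.isClosed hKO hid hmaps hinv ⟨hz, hz2⟩
  · refine RegularSublevel.boundaryGlueDiffeomorph_apply_of_not_mem hlev hΦm hΦ'm hΦt hΦ't hOo
      hKc.isClosed hKO hid hmaps hinv fun hK' => ?_
    obtain ⟨⟨a, t⟩, ⟨ha, -⟩, hx⟩ := hK'
    have hSp : par a ∈ S := hparS a ⟨by linarith [ha.1], by linarith [ha.2]⟩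
    rcases hz with hz | hz
    · exact hz (hx ▸ mem_flowSaturation_iff.2 ⟨t, par a, hSp, rfl⟩)
    · apply hz
      rw [← hx, hfinv, hσf _ hSp]
      exact ha

end PlanarLevelTwist

end Literature.Topology.FourManifolds

end
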